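import Mathlib.Logic.Function.DependsOn
import Mathlib.Data.Finset.Piecewise
import Mathlib.Data.Fintype.Powerset
import Mathlib.Tactic.LinearCombination
import Mathlib.Tactic.FieldSimp
import Literature.Barriers.QuantumAdvantage.BoundedEntanglement
import HarnessLib

/-!
# Splitting sets of a pure state: the Boolean algebra behind `p`-blockedness (Jozsa–Linden §3)

Topic `Literature/Barriers/QuantumAdvantage`; first file of the proof programme for the named fact
`Literature.Barriers.QuantumAdvantage.jozsaLinden2003_pblocked` (`BoundedEntanglement.lean`,
Jozsa–Linden 2003, §3, theorem `pblthm`). Jozsa–Linden describe a `p`-blocked pure state by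
"block locations" and "block states" and re-block after every two-qubit gate by "looking for an
equality of states" among the partitions of the two blocks touched (proof of lemma `ratpbl`,
Case 2), relying on the remark that "a pure state is `p`-blocked if and only if no `p+1` qubits
are all entangled together" (§3, after the definition of `p`-blocked). This file makes that
remark a theorem, in the amplitude picture used by the catalogue file (`IsProductAcross`,
`IsPBlocked` on `QReg N → ℂ`):

* `Splits ψ S` — the pure state (amplitude function) `ψ` is a product across the bipartition
  `(S, Sᶜ)` of the wires; `Splits.mul_eq` / `splits_iff_mul_eq` — the intrinsic rank-one
  criterion `ψ x · ψ y = ψ (x|_S ∪ y|_{Sᶜ}) · ψ (y|_S ∪ x|_{Sᶜ})`;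
* the splitting sets of any `ψ` form a Boolean algebra: `splits_empty`, `splits_univ`,
  `Splits.compl`, `Splits.inter`, `Splits.union`, `Splits.sdiff`, `splits_inf`;
* `atom ψ i` — the smallest splitting set containing the wire `i` ("the qubits entangled
  together with `i`"); atoms split (`splits_atom`) and partition the wires (`atom_eq_of_mem`);
* the bridge to the catalogue's block labellings: `IsProductAcross.splits_block`,
  `isProductAcross_of_splits`, and the headline `isPBlocked_iff_card_atom_le`:
  on `N ≥ 1` wires, **`ψ` is `p`-blocked iff every atom has at most `p` wires**.

These are the facts that make the re-blocking step of the simulation well defined (the new block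
structure inside the touched wires is the atom partition, and it is as fine as any `p`-blocked
partition); the locality of gates and the reduced-state formulas are in sibling files.

## Design notes

* Everything before the bridge is stated for amplitude functions `(ι → σ) → K` over a field `K`
  (wires `ι`, local alphabet `σ`); the catalogue's `QReg N → ℂ` is `ι = Fin N`, `σ = Bool`.
  Configurations glued along a set of wires are Mathlib's `Finset.piecewise`; "depends only on
  the wires in `S`" is Mathlib's `DependsOn`.
* No nonvanishing hypothesis: the zero function splits across every set (so its atoms are
  singletons, and indeed `0` is `1`-blocked on `N ≥ 1` wires for the catalogue's definition).
  The only degenerate case is `N = 0`, where `IsProductAcross` forces the empty product `ψ = 1`;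
  the bridge therefore assumes `0 < N`.
* Mathlib has no Schmidt rank / product-state API (searched `Schmidt`, `productState`,
  `IsProductState`, `separable`); the rank-one criterion is proved from scratch.

## References

* R. Jozsa, N. Linden, *On the role of entanglement in quantum-computational speed-up*, Proc. R.
  Soc. Lond. A 459 (2003) 2011–2032, arXiv:quant-ph/0201143: §3, definition of `p`-blocked
  states and the remark following it; proof of lemma `ratpbl`, Case 2.
* M. A. Nielsen, I. L. Chuang, *Quantum Computation and Quantum Information*, CUP 2010, §2.5
  (Schmidt decomposition: a pure state is a product across `(A, B)` iff its Schmidt rank is `1`).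
-/

namespace Literature.Barriers.QuantumAdvantage

open Finset

variable {ι σ K : Type*}

/-! ### Gluing configurations along a set of wires -/

section Piecewise

variable [DecidableEq ι]

/-- Gluing twice: taking `x` on `S`, then keeping the result only on `T`, is gluing `x` along
`S ∩ T`. [folklore] -/
theorem piecewise_piecewise_inter (S T : Finset ι) (x z : ι → σ) :
    T.piecewise (S.piecewise x z) z = (S ∩ T).piecewise x z := by
  ext i
  by_cases hT : i ∈ T <;> by_cases hS : i ∈ S <;> simp [Finset.piecewise, hT, hS]

/-- Gluing twice: taking `x` on `S`, then overwriting with `z` on `T`, is gluing `x` along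
`S \ T`. [folklore] -/
theorem piecewise_piecewise_sdiff (S T : Finset ι) (x z : ι → σ) :
    T.piecewise z (S.piecewise x z) = (S \ T).piecewise x z := by
  ext i
  by_cases hT : i ∈ T <;> by_cases hS : i ∈ S <;> simp [Finset.piecewise, hT, hS]

/-- Nested gluing with the same outer configuration: `x` on `T`, else (`x` on `S`, else `z`) is
`x` on `S ∪ T`, else `z`. [folklore] -/
theorem piecewise_piecewise_union (S T : Finset ι) (x z : ι → σ) :
    T.piecewise x (S.piecewise x z) = (S ∪ T).piecewise x z := by
  ext i
  by_cases hT : i ∈ T <;> by_cases hS : i ∈ S <;> simp [Finset.piecewise, hT, hS]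

end Piecewise

/-! ### Splitting sets -/

section Splits

variable [Field K]

/-- `Splits ψ S`: the amplitude function `ψ` (a pure state of the wires `ι`, local alphabet `σ`)
is a **product across the bipartition `(S, Sᶜ)`**: `ψ x = e x · f x` with `e` depending only on
the wires in `S` and `f` only on the wires outside `S` — Jozsa–Linden's "`ρ = ρ₁ ⊗ ρ₂`" for a pure
state and two blocks. [cite: JozsaLinden2003, §3 (definition of p-blocked, K = 2)] -/
def Splits (ψ : (ι → σ) → K) (S : Finset ι) : Prop :=
  ∃ e f : (ι → σ) → K, DependsOn e (S : Set ι) ∧ DependsOn f (↑S : Set ι)ᶜ ∧ ∀ x, ψ x = e x * f x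

variable {ψ : (ι → σ) → K}

/-- The zero state splits across every set. [folklore] -/
theorem splits_of_forall_eq_zero (h : ∀ x, ψ x = 0) (S : Finset ι) : Splits ψ S :=
  ⟨0, 0, fun _ _ _ => rfl, fun _ _ _ => rfl, fun x => by simp [h x]⟩

/-- Every state splits across `(∅, everything)`. [folklore] -/
theorem splits_empty (ψ : (ι → σ) → K) : Splits ψ ∅ :=
  ⟨1, ψ, fun _ _ _ => rfl, fun x y hxy => congrArg ψ (funext fun i => hxy i (by simp)),
    fun x => (one_mul _).symm⟩

/-- Every state splits across `(everything, ∅)`. [folklore] -/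
theorem splits_univ [Fintype ι] (ψ : (ι → σ) → K) : Splits ψ univ :=
  ⟨ψ, 1, fun x y hxy => congrArg ψ (funext fun i => hxy i (by simp)), fun _ _ _ => rfl,
    fun x => (mul_one _).symm⟩

variable [DecidableEq ι] {S T : Finset ι}

/-- **Rank-one identity of a product state**: if `ψ` splits across `(S, Sᶜ)` then
`ψ x · ψ y = ψ (x|_S, y|_{Sᶜ}) · ψ (y|_S, x|_{Sᶜ})` (the `2 × 2` minors of the matrix
`(ψ (a, b))_{a, b}` vanish). [cite: NielsenChuang2010, §2.5 (Schmidt rank one)] -/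
theorem Splits.mul_eq (h : Splits ψ S) (x y : ι → σ) :
    ψ x * ψ y = ψ (S.piecewise x y) * ψ (S.piecewise y x) := by
  obtain ⟨e, f, he, hf, hψ⟩ := h
  have h1 : e (S.piecewise x y) = e x := he fun _ hi => S.piecewise_eq_of_mem _ _ hi
  have h2 : f (S.piecewise x y) = f y := hf fun _ hi => S.piecewise_eq_of_notMem _ _ hi
  have h3 : e (S.piecewise y x) = e y := he fun _ hi => S.piecewise_eq_of_mem _ _ hi
  have h4 : f (S.piecewise y x) = f x := hf fun _ hi => S.piecewise_eq_of_notMem _ _ hi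
  rw [hψ x, hψ y, hψ (S.piecewise x y), hψ (S.piecewise y x), h1, h2, h3, h4]
  ring

/-- **Converse**: the rank-one identity implies splitting (over a field: glue along a point where
`ψ ≠ 0`; the zero function splits trivially). [cite: NielsenChuang2010, §2.5 (Schmidt rank one)] -/
theorem splits_of_mul_eq
    (h : ∀ x y, ψ x * ψ y = ψ (S.piecewise x y) * ψ (S.piecewise y x)) : Splits ψ S := by
  by_cases h0 : ∃ z, ψ z ≠ 0
  · obtain ⟨z, hz⟩ := h0
    refine ⟨fun x => ψ (S.piecewise x z), fun x => ψ (S.piecewise z x) / ψ z, ?_, ?_, ?_⟩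
    · intro x y hxy
      change ψ (S.piecewise x z) = ψ (S.piecewise y z)
      rw [S.piecewise_congr (fun i hi => hxy i hi) (fun _ _ => rfl)]
    · intro x y hxy
      change ψ (S.piecewise z x) / ψ z = ψ (S.piecewise z y) / ψ z
      rw [S.piecewise_congr (fun _ _ => rfl) (fun i hi => hxy i hi)]
    · intro x
      rw [mul_div_assoc', eq_div_iff hz, h x z]
  · push Not at h0
    exact ⟨0, 0, fun _ _ _ => rfl, fun _ _ _ => rfl, fun x => by simp [h0 x]⟩

/-- `ψ` splits across `(S, Sᶜ)` iff all rank-one identities hold. [cite: NielsenChuang2010, §2.5 (Schmidt rank one)] -/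
theorem splits_iff_mul_eq :
    Splits ψ S ↔ ∀ x y, ψ x * ψ y = ψ (S.piecewise x y) * ψ (S.piecewise y x) :=
  ⟨fun h => h.mul_eq, splits_of_mul_eq⟩

/-- Splitting sets are closed under intersection (for every `ψ`): with a base point `z`,
`ψ x = ψ (x|_{S∩T}, z) · [ψ (x|_{S∖T}, z) ψ (z|_S, x) / ψ z ^ 2]`, the bracket depending only on
the wires outside `S ∩ T`. This is the step that makes "the" block structure of a pure state well
defined. [cite: JozsaLinden2003, §3 (remark after the definition of p-blocked)] -/
theorem Splits.inter (hS : Splits ψ S) (hT : Splits ψ T) : Splits ψ (S ∩ T) := by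
  by_cases h0 : ∃ z, ψ z ≠ 0
  swap
  · push Not at h0
    exact splits_of_forall_eq_zero h0 _
  obtain ⟨z, hz⟩ := h0
  refine ⟨fun x => ψ ((S ∩ T).piecewise x z),
    fun x => ψ ((S \ T).piecewise x z) * ψ (S.piecewise z x) / ψ z ^ 2, ?_, ?_, ?_⟩
  · intro x y hxy
    change ψ ((S ∩ T).piecewise x z) = ψ ((S ∩ T).piecewise y z)
    rw [(S ∩ T).piecewise_congr (fun i hi => hxy i hi) (fun _ _ => rfl)]
  · intro x y hxy
    change ψ ((S \ T).piecewise x z) * ψ (S.piecewise z x) / ψ z ^ 2 =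
      ψ ((S \ T).piecewise y z) * ψ (S.piecewise z y) / ψ z ^ 2
    have e1 : (S \ T).piecewise x z = (S \ T).piecewise y z :=
      (S \ T).piecewise_congr (fun i hi => hxy i
        (Set.mem_compl fun h => (mem_sdiff.1 hi).2 (mem_inter.1 h).2)) (fun _ _ => rfl)
    have e2 : S.piecewise z x = S.piecewise z y :=
      S.piecewise_congr (fun _ _ => rfl) (fun i hi => hxy i
        (Set.mem_compl fun h => hi (mem_inter.1 h).1))
    rw [e1, e2]
  · intro x
    have h1 := hS.mul_eq x z
    have h2 := hT.mul_eq (S.piecewise x z) z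
    rw [piecewise_piecewise_inter, piecewise_piecewise_sdiff] at h2
    change ψ x = ψ ((S ∩ T).piecewise x z) * (ψ ((S \ T).piecewise x z) * ψ (S.piecewise z x) / ψ z ^ 2)
    rw [mul_div_assoc', eq_div_iff (pow_ne_zero 2 hz)]
    linear_combination ψ z * h1 + ψ (S.piecewise z x) * h2

variable [Fintype ι]

/-- Splitting sets are closed under complement (swap the two factors). [folklore] -/
theorem Splits.compl (h : Splits ψ S) : Splits ψ Sᶜ := by
  refine splits_of_mul_eq fun x y => ?_
  rw [Finset.piecewise_compl, Finset.piecewise_compl, mul_comm (ψ (S.piecewise y x))]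
  exact h.mul_eq x y

/-- A set splits iff its complement does. [folklore] -/
theorem splits_compl_iff : Splits ψ Sᶜ ↔ Splits ψ S :=
  ⟨fun h => by simpa using h.compl, Splits.compl⟩

/-- Splitting sets are closed under union. [folklore] -/
theorem Splits.union (hS : Splits ψ S) (hT : Splits ψ T) : Splits ψ (S ∪ T) := by
  have h := (hS.compl.inter hT.compl).compl
  rwa [compl_inter, compl_compl, compl_compl] at h

/-- Splitting sets are closed under difference. [folklore] -/
theorem Splits.sdiff (hS : Splits ψ S) (hT : Splits ψ T) : Splits ψ (S \ T) := by
  rw [sdiff_eq_inter_compl]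
  exact hS.inter hT.compl

/-- Splitting sets are closed under finite intersections. [folklore] -/
theorem splits_inf {α : Type*} (A : Finset α) (f : α → Finset ι) (h : ∀ a ∈ A, Splits ψ (f a)) :
    Splits ψ (A.inf f) := by
  classical
  induction A using Finset.induction_on with
  | empty => simpa using splits_univ ψ
  | insert a A ha ih =>
    rw [Finset.inf_insert, Finset.inf_eq_inter]
    exact (h a (mem_insert_self a A)).inter (ih fun b hb => h b (mem_insert_of_mem hb))

/-- Membership in a finite intersection of finsets. [folklore] -/
theorem mem_finset_inf_iff {α : Type*} (A : Finset α) (f : α → Finset ι) (j : ι) :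
    j ∈ A.inf f ↔ ∀ a ∈ A, j ∈ f a := by
  classical
  induction A using Finset.induction_on with
  | empty => simp
  | insert a A ha ih => simp [Finset.inf_insert, ih]

/-! ### Atoms: the wires entangled together with a given wire -/

/-- `atom ψ i`: the intersection of all splitting sets of `ψ` containing the wire `i` — the set of
wires "entangled together with `i`" in the pure state `ψ`; the atoms form the finest partition
of the wires across which `ψ` is a product state (`splits_atom`, `atom_eq_of_mem`).
[cite: JozsaLinden2003, §3 (remark after the definition of p-blocked: "no p+1 qubits are all entangled together")] -/
noncomputable def atom (ψ : (ι → σ) → K) (i : ι) : Finset ι :=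
  open scoped Classical in (univ.filter fun S : Finset ι => Splits ψ S ∧ i ∈ S).inf id

/-- Membership in an atom: `j ∈ atom ψ i` iff `j` lies in every splitting set containing `i`. [folklore] -/
theorem mem_atom {i j : ι} : j ∈ atom ψ i ↔ ∀ S : Finset ι, Splits ψ S → i ∈ S → j ∈ S := by
  classical
  unfold atom
  rw [mem_finset_inf_iff]
  simp only [mem_filter, mem_univ, true_and, id_eq, and_imp]

/-- A wire lies in its own atom. [folklore] -/
theorem mem_atom_self (ψ : (ι → σ) → K) (i : ι) : i ∈ atom ψ i :=
  mem_atom.2 fun _ _ hi => hi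

/-- An atom is contained in every splitting set containing its wire. [folklore] -/
theorem atom_subset_of_splits {i : ι} (hS : Splits ψ S) (hi : i ∈ S) : atom ψ i ⊆ S :=
  fun _ hj => mem_atom.1 hj S hS hi

/-- **Atoms split**: `ψ` is a product across `(atom ψ i, rest)` (a finite intersection of
splitting sets splits). [cite: JozsaLinden2003, §3 (remark after the definition of p-blocked)] -/
theorem splits_atom (ψ : (ι → σ) → K) (i : ι) : Splits ψ (atom ψ i) := by
  classical
  unfold atom
  exact splits_inf _ _ fun S hS => by simpa using (mem_filter.1 hS).2.1

/-- Being entangled together is symmetric: `j ∈ atom ψ i → i ∈ atom ψ j` (a splitting set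
containing `j` but not `i` would have a complement splitting `i` from `j`). [folklore] -/
theorem mem_atom_comm {i j : ι} (h : j ∈ atom ψ i) : i ∈ atom ψ j := by
  refine mem_atom.2 fun S hS hj => ?_
  by_contra hi
  have := mem_atom.1 h Sᶜ hS.compl (mem_compl.2 hi)
  exact (mem_compl.1 this) hj

/-- **Atoms partition the wires**: two atoms that meet coincide. [folklore] -/
theorem atom_eq_of_mem {i j : ι} (h : j ∈ atom ψ i) : atom ψ j = atom ψ i :=
  Subset.antisymm (atom_subset_of_splits (splits_atom ψ i) h)
    (atom_subset_of_splits (splits_atom ψ j) (mem_atom_comm h))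

end Splits

/-! ### Bridge to block labellings: `IsProductAcross` and `IsPBlocked` -/

section Bridge

open Literature.Computability.Cryptography

variable {N : ℕ} {blk : Fin N → ℕ} {ψ : QReg N → ℂ}

/-- The block with label `k` of a labelling `blk`. [cite: JozsaLinden2003, §3 (proof of lemma ratpbl, (a) block locations)] -/
abbrev block (blk : Fin N → ℕ) (k : ℕ) : Finset (Fin N) := univ.filter fun i => blk i = k

/-- Gluing along the union of the blocks with labels in `insert k A` is gluing along block `k`
on top of gluing along the blocks with labels in `A`. [folklore] -/
theorem piecewise_blocks_insert (blk : Fin N → ℕ) (k : ℕ) (A : Finset ℕ) (x z : QReg N) :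
    (univ.filter fun i => blk i ∈ insert k A).piecewise x z =
      (block blk k).piecewise x ((univ.filter fun i => blk i ∈ A).piecewise x z) := by
  ext i
  by_cases hk : blk i = k <;> by_cases hA : blk i ∈ A <;> simp [Finset.piecewise, hk, hA]

/-- **A product across a block labelling splits across each block** (the factor of block `k`
against the product of the other factors). [cite: JozsaLinden2003, §3 (definition of p-blocked)] -/
theorem IsProductAcross.splits_block (h : IsProductAcross blk ψ) (k : ℕ) : Splits ψ (block blk k) := by
  obtain ⟨φ, hφ, hψ⟩ := h
  by_cases hk : k ∈ univ.image blk
  · refine ⟨φ k, fun x => ∏ k' ∈ (univ.image blk).erase k, φ k' x, ?_, ?_, ?_⟩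
    · intro x y hxy
      exact hφ k x y fun i hi => hxy i (by simpa using hi)
    · intro x y hxy
      refine Finset.prod_congr rfl fun k' hk' => hφ k' x y fun i hi => hxy i ?_
      have hne : k' ≠ k := (mem_erase.1 hk').1
      simp only [coe_filter, mem_univ, true_and, Set.mem_compl_iff, Set.mem_setOf_eq]
      exact fun h => hne (hi.symm.trans h)
    · intro x
      rw [hψ x, ← Finset.mul_prod_erase _ _ hk]
  · have hempty : block blk k = ∅ := by
      ext i
      simp only [mem_filter, mem_univ, true_and, notMem_empty, iff_false]
      exact fun h => hk (mem_image.2 ⟨i, mem_univ i, h⟩)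
    rw [hempty]
    exact splits_empty ψ

/-- Telescoping the rank-one identities over a family of splitting blocks: gluing `x` along the
union of the blocks with labels in `A` costs one base-point factor `ψ z` per block.
[cite: NielsenChuang2010, §2.5 (Schmidt rank one)] -/
theorem mul_pow_eq_prod_of_splits_block (h : ∀ k, Splits ψ (block blk k)) (x z : QReg N)
    (A : Finset ℕ) :
    ψ ((univ.filter fun i => blk i ∈ A).piecewise x z) * ψ z ^ A.card =
      ψ z * ∏ k ∈ A, ψ ((block blk k).piecewise x z) := by
  induction A using Finset.induction_on with
  | empty =>
    rw [card_empty, pow_zero, mul_one, prod_empty, mul_one]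
    congr 1
    ext i
    simp [Finset.piecewise]
  | insert k A hkA ih =>
    have hid := (h k).mul_eq ((univ.filter fun i => blk i ∈ insert k A).piecewise x z) z
    have e1 : (block blk k).piecewise ((univ.filter fun i => blk i ∈ insert k A).piecewise x z) z =
        (block blk k).piecewise x z := by
      ext i
      by_cases hk : blk i = k <;> simp [Finset.piecewise, hk]
    have e2 : (block blk k).piecewise z ((univ.filter fun i => blk i ∈ insert k A).piecewise x z) =
        (univ.filter fun i => blk i ∈ A).piecewise x z := by
      ext i
      by_cases hk : blk i = k
      · have hA : blk i ∉ A := hk ▸ hkA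
        simp [Finset.piecewise, hk, hkA]
      · by_cases hA : blk i ∈ A <;> simp [Finset.piecewise, hk, hA]
    rw [e1, e2] at hid
    rw [card_insert_of_notMem hkA, prod_insert hkA, pow_succ', ← mul_assoc, hid]
    linear_combination ψ ((block blk k).piecewise x z) * ih

/-- **A state that splits across every block of a labelling is a product across the labelling**
(on `N ≥ 1` wires; for `N = 0` the catalogue's `IsProductAcross` is the empty product and forces
`ψ = 1`). The factors are `ψ` glued with a base point along each block, normalised by the base
amplitude. [cite: JozsaLinden2003, §3 (definition of p-blocked)] -/
theorem isProductAcross_of_splits (hN : 0 < N) (h : ∀ k, Splits ψ (block blk k)) :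
    IsProductAcross blk ψ := by
  set I := univ.image blk with hI
  have hk₀ : blk ⟨0, hN⟩ ∈ I := mem_image_of_mem blk (mem_univ _)
  by_cases h0 : ∃ z, ψ z ≠ 0
  swap
  · push Not at h0
    exact ⟨fun _ _ => 0, fun _ _ _ _ => rfl, fun x => by rw [h0 x, Finset.prod_eq_zero hk₀ rfl]⟩
  obtain ⟨z, hz⟩ := h0
  set k₀ := blk ⟨0, hN⟩ with hk₀def
  refine ⟨fun k x => ψ ((block blk k).piecewise x z) * (if k = k₀ then 1 else (ψ z)⁻¹),
    fun k x y hxy => ?_, fun x => ?_⟩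
  · change ψ ((block blk k).piecewise x z) * _ = ψ ((block blk k).piecewise y z) * _
    rw [(block blk k).piecewise_congr (fun i hi => hxy i (by simpa using hi)) (fun _ _ => rfl)]
  · have key := mul_pow_eq_prod_of_splits_block h x z I
    have huniv : (univ.filter fun i => blk i ∈ I) = univ := by
      ext i
      simp [hI]
    rw [huniv, Finset.piecewise_univ] at key
    obtain ⟨m, hm⟩ : ∃ m, I.card = m + 1 :=
      ⟨I.card - 1, by have := Finset.card_pos.2 ⟨_, hk₀⟩; omega⟩
    have hite : ∏ k ∈ I, (if k = k₀ then (1 : ℂ) else (ψ z)⁻¹) = (ψ z)⁻¹ ^ m := by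
      rw [← Finset.mul_prod_erase I _ hk₀, if_pos rfl, one_mul,
        Finset.prod_congr rfl (fun k hk => if_neg (mem_erase.1 hk).1), Finset.prod_const,
        Finset.card_erase_of_mem hk₀, hm, Nat.add_sub_cancel]
    change ψ x = ∏ k ∈ I, ψ ((block blk k).piecewise x z) * (if k = k₀ then (1 : ℂ) else (ψ z)⁻¹)
    rw [Finset.prod_mul_distrib, hite, inv_pow, ← div_eq_mul_inv, eq_div_iff (pow_ne_zero _ hz)]
    rw [hm, pow_succ, ← mul_assoc, mul_comm (ψ z) (∏ k ∈ I, ψ ((block blk k).piecewise x z))] at key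
    exact mul_right_cancel₀ hz key

/-- A `p`-blocked state has atoms of size at most `p` (the block of a wire splits and contains
the wire, hence contains its atom). [cite: JozsaLinden2003, §3 (remark after the definition of p-blocked)] -/
theorem IsPBlocked.card_atom_le {p : ℕ} (h : IsPBlocked p ψ) (i : Fin N) : (atom ψ i).card ≤ p := by
  obtain ⟨blk, hcard, hprod⟩ := h
  exact (card_le_card (atom_subset_of_splits (hprod.splits_block (blk i)) (by simp))).trans
    (hcard (blk i))

/-- Labelling every wire by the least wire of its atom realises the atom partition as a block
labelling: the block of the label of `i` is exactly `atom ψ i`. [folklore] -/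
theorem block_atomLabel_eq (ψ : QReg N → ℂ) (i : Fin N) :
    block (fun j => (((atom ψ j).min' ⟨j, mem_atom_self ψ j⟩ : Fin N) : ℕ))
      (((atom ψ i).min' ⟨i, mem_atom_self ψ i⟩ : Fin N) : ℕ) = atom ψ i := by
  ext j
  simp only [mem_filter, mem_univ, true_and]
  constructor
  · intro hj
    have hm : (atom ψ j).min' ⟨j, mem_atom_self ψ j⟩ = (atom ψ i).min' ⟨i, mem_atom_self ψ i⟩ :=
      Fin.ext hj
    have h1 : (atom ψ i).min' ⟨i, mem_atom_self ψ i⟩ ∈ atom ψ j := hm ▸ min'_mem _ _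
    have h2 : (atom ψ i).min' ⟨i, mem_atom_self ψ i⟩ ∈ atom ψ i := min'_mem _ _
    rw [← atom_eq_of_mem h2, atom_eq_of_mem h1]
    exact mem_atom_self ψ j
  · intro hj
    simp [atom_eq_of_mem hj]

/-- Conversely, on `N ≥ 1` wires a state all of whose atoms have at most `p` wires is `p`-blocked,
the blocks being the atoms. [cite: JozsaLinden2003, §3 (remark after the definition of p-blocked)] -/
theorem isPBlocked_of_card_atom_le {p : ℕ} (hN : 0 < N) (h : ∀ i, (atom ψ i).card ≤ p) :
    IsPBlocked p ψ := by
  set lab : Fin N → ℕ := fun j => (((atom ψ j).min' ⟨j, mem_atom_self ψ j⟩ : Fin N) : ℕ) with hlab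
  have hblock : ∀ k, block lab k = ∅ ∨ ∃ i, block lab k = atom ψ i := by
    intro k
    by_cases hk : ∃ i, lab i = k
    · obtain ⟨i, rfl⟩ := hk
      exact Or.inr ⟨i, block_atomLabel_eq ψ i⟩
    · push Not at hk
      refine Or.inl ?_
      ext j
      simpa using hk j
  refine ⟨lab, fun k => ?_, isProductAcross_of_splits hN fun k => ?_⟩
  · change (block lab k).card ≤ p
    rcases hblock k with hk | ⟨i, hk⟩
    · simp [hk]
    · rw [hk]
      exact h i
  · rcases hblock k with hk | ⟨i, hk⟩
    · rw [hk]
      exact splits_empty ψ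
    · rw [hk]
      exact splits_atom ψ i

/-- **Jozsa–Linden's characterisation**: on `N ≥ 1` wires, a pure state is `p`-blocked iff no
`p + 1` wires are all entangled together, i.e. iff every atom has at most `p` wires.
[cite: JozsaLinden2003, §3 ("a pure state is p-blocked if and only if no p+1 qubits are all entangled together")] -/
theorem isPBlocked_iff_card_atom_le {p : ℕ} (hN : 0 < N) :
    IsPBlocked p ψ ↔ ∀ i, (atom ψ i).card ≤ p :=
  ⟨fun h => h.card_atom_le, isPBlocked_of_card_atom_le hN⟩

end Bridge

end Literature.Barriers.QuantumAdvantage
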